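import Literature.MathematicalPhysics.QuantumFieldTheory.LatticeGaugeProofs
import HarnessLib

/-!
# `stub_torusLimitTranslationInvariant`: periodic infinite-volume limit points are `ℤ^d`-invariant

Stub (TI) of crux `FibreToTorus` (stmt-QuantumFields-16244), line `Sketch` (ergodic-selection cut
T⁺ → NS → U_tr → TI → V), route `ContractibleFibre`.  Every subsequential infinite-volume limit point
`μ ∈ infiniteVolumeLimitPoints ρ β` of the torus Wilson states `μ_{Λ_{L_k+1}, β}` is invariant under
all lattice translations `configShift v`, `v ∈ ℤ^d`.

Proof (Osterwalder–Seiler 1978 §2, periodic boundary conditions; folklore): the torus Wilson state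
is invariant under torus translations (`wilsonMeasure_map_torusConfigShift`) and the periodic lift
intertwines `configShift v` with the torus translation by `v mod L`
(`toTorusObservable_comp_configShift`), so for a bounded continuous cylinder observable `F` the
torus expectations of `F ∘ configShift v` and of `F` coincide for every `L`; along the subsequence
defining `μ` the first converge to `∫ F d(μ ∘ θ_v⁻¹)` (a translate of a cylinder observable is a
cylinder observable) and the second to `∫ F dμ`, hence the two probability measures `μ.map
(configShift v)` and `μ` have the same integrals of bounded continuous cylinder observables and
coincide (`measure_eq_of_integral_cylinder_eq`: finite-dimensional marginals on the compact
metrisable `G^S` are determined by bounded continuous functions, and a probability measure on the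
product σ-algebra by its marginals).
-/

noncomputable section

open MeasureTheory Filter Topology
open Literature.Probability.LatticeModels (Site)
open Literature.MathematicalPhysics.QuantumLattice (LGConfig ZdEdge configShift configShift_apply
  IsCylinder infiniteVolumeLimitPoints IsInfiniteVolumeLimitAlong IsZdTranslationInvariant torusLift
  torusEdge toTorusObservable)
open Literature.MathematicalPhysics.QuantumFieldTheory hiding ZdEdge

namespace Summit.QuantumFields.YangMills.Theorems.FibreToTorus

variable {d N : ℕ} {G : Type*} [Group G] [TopologicalSpace G] [IsTopologicalGroup G]
  [CompactSpace G] [MeasurableSpace G] [BorelSpace G]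

/-- **Translates of a limit point have the same cylinder integrals, along the same subsequence.**
If `μ` is the infinite-volume limit of the torus Wilson states along `L_k + 1`, then for every
bounded continuous cylinder observable `F` and every `v ∈ ℤ^d`,
`∫ F d(μ.map (configShift v)) = ∫ F dμ`: both sides are the limit of the same sequence of torus
expectations, since `⟨(F ∘ θ_v) ∘ lift⟩_L = ⟨(F ∘ lift) ∘ θ^{torus}_{v mod L}⟩_L = ⟨F ∘ lift⟩_L`
(Osterwalder–Seiler 1978 §2). [folklore] -/
theorem integral_map_configShift_eq_of_isInfiniteVolumeLimitAlong
    (ρ : G →* Matrix (Fin N) (Fin N) ℂ) {β : ℝ} {L : ℕ → ℕ} {μ : Measure (LGConfig d G)}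
    (hμ : IsInfiniteVolumeLimitAlong (d := d) ρ β L μ) (v : Site d)
    {F : LGConfig d G → ℝ} {S : Finset (ZdEdge d)} (hFS : IsCylinder F S) (hFc : Continuous F)
    (hFb : ∃ C, ∀ U, |F U| ≤ C) :
    ∫ U, F U ∂(μ.map (configShift v)) = ∫ U, F U ∂μ := by
  obtain ⟨_, hconv⟩ := hμ
  rw [integral_map_equiv]
  have h := hconv (F ∘ configShift v) _ (IsCylinder.comp_configShift hFS v)
    (hFc.comp (continuous_configShift v))
    (by obtain ⟨C, hC⟩ := hFb; exact ⟨C, fun U => hC _⟩)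
  have hE : ∀ L' : ℕ, wilsonExpectation (L := L' + 1) ρ β
      (toTorusObservable (L' + 1) (F ∘ configShift v)) =
      wilsonExpectation (L := L' + 1) ρ β (toTorusObservable (L' + 1) F) := fun L' => by
    rw [toTorusObservable_comp_configShift, wilsonExpectation_comp_torusConfigShift]
  simp only [hE, Function.comp_apply] at h
  exact tendsto_nhds_unique h (hconv F S hFS hFc hFb)

/-- **Periodic infinite-volume limit points are translation invariant.** For
`μ ∈ infiniteVolumeLimitPoints ρ β` and `v ∈ ℤ^d`, `μ.map (configShift v) = μ`: the two probability
measures have the same integrals of bounded continuous cylinder observables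
(`integral_map_configShift_eq_of_isInfiniteVolumeLimitAlong`), hence coincide
(`measure_eq_of_integral_cylinder_eq`) (Osterwalder–Seiler 1978 §2; Seiler LNP 159 Ch. 2). [folklore] -/
theorem isZdTranslationInvariant_of_mem_infiniteVolumeLimitPoints [T2Space G]
    [SecondCountableTopology G] (ρ : G →* Matrix (Fin N) (Fin N) ℂ) {β : ℝ}
    {μ : Measure (LGConfig d G)} (hμ : μ ∈ infiniteVolumeLimitPoints (d := d) ρ β) :
    IsZdTranslationInvariant μ := by
  intro v
  obtain ⟨L, -, hlim⟩ := hμ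
  haveI : IsProbabilityMeasure μ := hlim.1
  haveI : IsProbabilityMeasure (μ.map (configShift v)) :=
    Measure.isProbabilityMeasure_map (configShift v).measurable.aemeasurable
  exact measure_eq_of_integral_cylinder_eq fun F S hFS hFc hFb =>
    integral_map_configShift_eq_of_isInfiniteVolumeLimitAlong ρ hlim v hFS hFc hFb

/-- **Registered stub `stub_torusLimitTranslationInvariant` (TI) of line `Sketch`, crux `FibreToTorus`:**
every periodic infinite-volume limit point of the torus Wilson states of lattice gauge theory with a
compact (Hausdorff, second countable) gauge group is `ℤ^d`-translation invariant (closed statement,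
byte-for-byte the registered signature; the continuity of `ρ` is not needed). [folklore] -/
theorem stub_torusLimitTranslationInvariant :
    ∀ (d N : ℕ) (G : Type) [Group G] [TopologicalSpace G] [IsTopologicalGroup G] [CompactSpace G]
      [MeasurableSpace G] [BorelSpace G] [T2Space G] [SecondCountableTopology G]
      (ρ : G →* Matrix (Fin N) (Fin N) ℂ), Continuous ρ → ∀ (β : ℝ) (μ : MeasureTheory.Measure (LGConfig d G)),
        μ ∈ infiniteVolumeLimitPoints (d := d) ρ β → IsZdTranslationInvariant μ :=
  fun _ _ _ _ _ _ _ _ _ _ _ ρ _ _ _ hμ =>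
    isZdTranslationInvariant_of_mem_infiniteVolumeLimitPoints ρ hμ

end Summit.QuantumFields.YangMills.Theorems.FibreToTorus

end
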